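import Mathlib
import Summits.KontsevichZagierPeriods.Zeta5Search.ClusterValuation
import HarnessLib

/-!
# ζ(5) search — the elementary parts (T1-i), (T1-ii), (T1-iv) of gen-2 g7's floor inequality are THEOREMS

Cell `pub-zeta5` (HONEST FRAMING: systematic search; no irrationality claim unless certified), typer seat
generation 8.  Discharges BY NAME three of the five (T1) statements of `Zeta5Search/ClusterValuation.lean` §2
(REPORT-gen2-g7 §1, "a ≤ Σ_k N_{1k} ≤ N"):

* `lawWLeOne_holds : LawWLeOne` — `law_W = min(1,⌊(d+1)/p⌋) + a_p − N_p ≤ 1`;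
* `lawWNonpos_holds : LawWNonpos` — `law_W ≤ 0` beyond the excess (`p > d+1`);
* `lawUNonpos_holds : LawUNonpos` — `law_U = min(1,⌊d/p⌋) − 1 − N_p ≤ 0`.

The one combinatorial input is `topPartners_le_pairFloors`: every "top partner" `k ≠ k₀` of the least parameter
(`b₀ − b_k − b_min ≥ p`) contributes a unit `⌊(b₀ − b_k − b_{k₀})/p⌋ ≥ 1` to the pair-floor sum, all of whose terms are
non-negative on the polytope (`b_i + b_k ≤ b₀`).  The genuine floor inequalities (T1-iii)/(T1-v) are not treated here.
Integer bookkeeping; nothing about irrationality.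
-/

noncomputable section

open Finset

namespace Summit.KontsevichZagierPeriods.Zeta5Search.ClusterValuation

open Summit.KontsevichZagierPeriods.Zeta5Search.DualSeries (InBox)
open Summit.KontsevichZagierPeriods.Zeta5Search.WedgeDictionary (dOf)
open Summit.KontsevichZagierPeriods.Zeta5Search.CasoratianValuation (InPolytope pairFloors refund refundW bMin topPartners)

/-! ### The pair floors dominate the top partners -/

/-- The pair term `⌊(b₀ − b_{i+1} − b_{k+1})/p⌋`. -/
def pairTerm (b : ℕ → ℤ) (p : ℕ) (i k : ℕ) : ℤ := (b 0 - b (i + 1) - b (k + 1)) / (p : ℤ)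

/-- Pair terms are non-negative on the polytope. -/
theorem pairTerm_nonneg (b : ℕ → ℤ) (hb : InPolytope b) (p : ℕ) {i k : ℕ} (hi : i < 7) (hk : k < 7) :
    0 ≤ pairTerm b p i k := by
  have h1 := hb.2.1 i (mem_range.2 hi)
  have h2 := hb.2.1 k (mem_range.2 hk)
  exact Int.ediv_nonneg (by omega) (by positivity)

/-- The least parameter is attained. -/
theorem exists_bMin (b : ℕ → ℤ) : ∃ i₀ ∈ range 7, b (i₀ + 1) = bMin b := by
  have h := min'_mem ((range 7).image fun i => b (i + 1)) (by simp)
  obtain ⟨i₀, hi₀, he⟩ := mem_image.1 h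
  exact ⟨i₀, hi₀, he⟩

/-- The pairs through a fixed index are a sub-sum of the pair floors:
`Σ_{i ≠ i₀} ⌊(b₀ − b_i − b_{i₀})/p⌋ ≤ N_p`. -/
theorem sum_pairs_through_le (b : ℕ → ℤ) (hb : InPolytope b) (p : ℕ) {i₀ : ℕ} (hi₀ : i₀ ∈ range 7) :
    ∑ i ∈ (range 7).erase i₀, pairTerm b p (min i i₀) (max i i₀) ≤ pairFloors b p := by
  -- the star of `i₀`: terms `(i, i₀)` with `i < i₀` and `(i₀, k)` with `k > i₀`
  have hsplit : ∑ i ∈ (range 7).erase i₀, pairTerm b p (min i i₀) (max i i₀) =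
      ∑ i ∈ (range 7).filter (fun i => i < i₀), pairTerm b p i i₀ +
        ∑ k ∈ (range 7).filter (fun k => i₀ < k), pairTerm b p i₀ k := by
    have hunion : (range 7).erase i₀ = (range 7).filter (fun i => i < i₀) ∪ (range 7).filter (fun k => i₀ < k) := by
      ext i; simp only [mem_erase, mem_range, mem_union, mem_filter]; omega
    have hdisj : Disjoint ((range 7).filter (fun i => i < i₀)) ((range 7).filter (fun k => i₀ < k)) := by
      rw [disjoint_filter]; intro i _ h; omega
    rw [hunion, sum_union hdisj]
    congr 1
    · refine sum_congr rfl fun i hi => ?_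
      have := (mem_filter.1 hi).2
      rw [min_eq_left this.le, max_eq_right this.le]
    · refine sum_congr rfl fun k hk => ?_
      have := (mem_filter.1 hk).2
      rw [min_eq_right this.le, max_eq_left this.le]
  rw [hsplit]
  -- `pairFloors` as a sum over `i` of the row sums `Σ_{k > i}`
  have hrow : ∀ i ∈ range 7, ∑ k ∈ range 7, (if i < k then (b 0 - b (i + 1) - b (k + 1)) / (p : ℤ) else 0) =
      ∑ k ∈ (range 7).filter (fun k => i < k), pairTerm b p i k := by
    intro i _
    rw [sum_filter]
    rfl
  unfold pairFloors
  rw [sum_congr rfl hrow]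
  -- lower bound: keep row `i₀` entirely, and from every row `i < i₀` keep the term `k = i₀`
  have hrows : ∀ i ∈ range 7, (if i < i₀ then pairTerm b p i i₀ else 0) + (if i = i₀ then
      ∑ k ∈ (range 7).filter (fun k => i₀ < k), pairTerm b p i₀ k else 0) ≤
      ∑ k ∈ (range 7).filter (fun k => i < k), pairTerm b p i k := by
    intro i hi
    have hi7 := mem_range.1 hi
    have hi₀7 := mem_range.1 hi₀
    by_cases h1 : i < i₀
    · rw [if_pos h1, if_neg (by omega), add_zero]
      have hmem : i₀ ∈ (range 7).filter (fun k => i < k) := mem_filter.2 ⟨hi₀, h1⟩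
      rw [← add_sum_erase _ _ hmem]
      have : 0 ≤ ∑ k ∈ ((range 7).filter (fun k => i < k)).erase i₀, pairTerm b p i k :=
        sum_nonneg fun k hk => pairTerm_nonneg b hb p hi7 (mem_range.1 (mem_filter.1 (mem_erase.1 hk).2).1)
      linarith
    · rw [if_neg h1, zero_add]
      by_cases h2 : i = i₀
      · subst h2; rw [if_pos rfl]
      · rw [if_neg h2]
        exact sum_nonneg fun k hk => pairTerm_nonneg b hb p hi7 (mem_range.1 (mem_filter.1 hk).1)
  have hsum := sum_le_sum hrows
  rw [sum_add_distrib, ← sum_filter, sum_ite_eq' (range 7) i₀, if_pos hi₀] at hsum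
  exact hsum

/-- **`a_p(b) ≤ N_p(b)`**: the top partners are dominated by the pair floors (`p ≥ 1`). -/
theorem topPartners_le_pairFloors (b : ℕ → ℤ) (hb : InPolytope b) {p : ℕ} (hp : 1 ≤ p) :
    topPartners b p ≤ pairFloors b p := by
  obtain ⟨i₀, hi₀, he⟩ := exists_bMin b
  set S := (range 7).filter fun i => (p : ℤ) ≤ b 0 - b (i + 1) - bMin b with hS
  -- `topPartners = #(S.erase i₀)`
  have htop : topPartners b p = ((S.erase i₀).card : ℤ) := by
    unfold topPartners
    rw [← hS]
    by_cases hc : (p : ℤ) ≤ b 0 - 2 * bMin b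
    · have hmem : i₀ ∈ S := by
        rw [hS, mem_filter]; exact ⟨hi₀, by rw [he]; linarith⟩
      rw [if_pos hc, card_erase_of_mem hmem]
      have := card_pos.2 ⟨i₀, hmem⟩
      omega
    · have hnmem : i₀ ∉ S := by
        rw [hS, mem_filter]; intro h; apply hc; rw [he] at h; linarith [h.2]
      rw [if_neg hc, erase_eq_of_notMem hnmem]; ring
  rw [htop]
  refine le_trans ?_ (sum_pairs_through_le b hb p hi₀)
  -- each top partner contributes at least one unit
  have h1 : ((S.erase i₀).card : ℤ) = ∑ i ∈ S.erase i₀, (1 : ℤ) := by simp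
  rw [h1]
  have hsub : S.erase i₀ ⊆ (range 7).erase i₀ := erase_subset_erase _ (filter_subset _ _)
  refine le_trans (sum_le_sum fun i hi => ?_) (sum_le_sum_of_subset_of_nonneg hsub fun i hi _ => ?_)
  · -- `1 ≤ ⌊(b₀ − b_i − b_{i₀})/p⌋`
    have hiS := (mem_filter.1 (mem_erase.1 hi).2).2
    have hval : pairTerm b p (min i i₀) (max i i₀) = (b 0 - b (i + 1) - b (i₀ + 1)) / (p : ℤ) := by
      unfold pairTerm
      rcases le_total i i₀ with h | h
      · rw [min_eq_left h, max_eq_right h]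
      · rw [min_eq_right h, max_eq_left h]; ring_nf
    rw [hval, he]
    exact Int.le_ediv_of_mul_le (by exact_mod_cast hp) (by linarith)
  · have hi7 := mem_range.1 (mem_erase.1 hi).2
    have hi₀7 := mem_range.1 hi₀
    exact pairTerm_nonneg b hb p (by rcases le_total i i₀ with h | h <;> simp [h] <;> omega)
      (by rcases le_total i i₀ with h | h <;> simp [h] <;> omega)

/-! ### The three elementary laws -/

/-- `N_p ≥ 0` on the polytope. -/
theorem pairFloors_nonneg (b : ℕ → ℤ) (hb : InPolytope b) (p : ℕ) : 0 ≤ pairFloors b p := by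
  unfold pairFloors
  refine sum_nonneg fun i hi => sum_nonneg fun k hk => ?_
  split_ifs
  · exact pairTerm_nonneg b hb p (mem_range.1 hi) (mem_range.1 hk)
  · exact le_rfl

/-- **(T1-i) is a theorem**: `law_W ≤ 1`. -/
theorem lawWLeOne_holds : LawWLeOne := by
  intro b p hb hp5
  have h1 : refundW b p ≤ 1 := min_le_left _ _
  have h2 := topPartners_le_pairFloors b hb (show 1 ≤ p by omega)
  unfold lawW; linarith

/-- **(T1-ii) is a theorem**: `law_W ≤ 0` for `p > d(b)+1`. -/
theorem lawWNonpos_holds : LawWNonpos := by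
  intro b p hb hp5 hpd
  have hd0 : 0 ≤ dOf b := by have := hb.2.2; unfold dOf; linarith
  have h1 : refundW b p = 0 := by
    unfold refundW
    rw [Int.ediv_eq_zero_of_lt (by omega) (by omega)]; simp
  have h2 := topPartners_le_pairFloors b hb (show 1 ≤ p by omega)
  unfold lawW; linarith

/-- **(T1-iv) is a theorem**: `law_U ≤ 0`. -/
theorem lawUNonpos_holds : LawUNonpos := by
  intro b p hb _hp5
  have h1 : refund b p ≤ 1 := min_le_left _ _
  have h2 := pairFloors_nonneg b hb p
  unfold lawU; linarith

end Summit.KontsevichZagierPeriods.Zeta5Search.ClusterValuation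

end
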